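import Literature.MathematicalPhysics.QuantumFieldTheory.Balaban1983to89.B9RWSums346LetterL2FromMajorants
import Literature.MathematicalPhysics.QuantumFieldTheory.Balaban1983to89.B9Eq346OneSidedLegsAtPinsL2

/-!
# `Balaban1983to89.B9RWSums346MixedFactorAtPins` — T. Bałaban, *Propagators for lattice gauge theories in a background field*, Commun. Math. Phys. **99**
# (1985) 389–434 [Balaban1985BackgroundPropagators] (3.88)–(3.89) p. 409 ∕ (3.46) p. 398 ∕ Cor 3.6 p. 408: ★★★ **ROWS 18's THIRD-ORDER MIXED FACTOR SCHEMA
# `FactorsL2Mixed37Dir` AT THE N06 CERTIFICATE's PINS, MEMBER LEVEL** — the knit-ready face: the schema FROM the certificate's displayed data (`StaticOK`, `Sizes.Nonneg`,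
# `Facts347`, `Ineq261`, `Identities₂`) plus the two letter transposes, the two letter-free legs being THEOREMS at the pins (`B9Eq346OneSidedLegsAtPinsL2`)

statement-level skeleton of published theorems with citation tags; proofs where landed; nothing here is a claim about the Yang–Mills mass gap

THE PRINT.  (3.88)–(3.89) p. 409: *«Δ′_aG′₀ = I − Σ_□K(h_□)G′_□h_□ = I − R′ … The operator K(h_□)G_□h_□ satisfies the inequality (3.89), hence it is small»*; (3.46) p. 398;
Cor 3.6 p. 408 («constants independent of □»); [4] (2.39)–(2.44) pp. 229–230, (2.52)–(2.55) p. 232, Lemma 2.1 (2.61) p. 234.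

WHY THIS FILE (cell `pub-ymgap`, Track A node N06 [B9], rows 18; width seat `pub-ymgap-dag-n06-w7`, g1, 2026-08-28).  The four prequels of this seat give, BY NAME:
`factorsL2Mixed37Dir_of_identities₂_legs` (displayed data + transposes + legs `hMix hOne` ⊢ the schema) and `blockBd_mixedLegR_memberY` ∕ `blockBd_oneLeg_memberY` (the two
legs at the pins, `∃`-packaged constants).  THIS FILE composes them into ONE member-level call for the certificate owner:
* §1 `factorsL2Mixed37Dir_mono` — the schema is monotone in its constant (up) and its rate (down): the knit matches its own numerics `(pM.θM, p.δ₀)`.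
* §3 `sizes_le_of_bounded`, ★ `factorsL2Mixed37Dir_uniform_of_bounded` — under the certificate's `Sizes.Bounded Kc θ₀ Cℓ M` (`M, Cℓ ≥ 1`) the letter sizes leave
  the constant: `θ_F ≤ θ⋆ = ((d+1)·θ₀·√(L₀)·e·B_F + θ₀·√(L₀²)·e·B_F·L₀)·c₁`, member-uniform.
* §2 ★★★ `factorsL2Mixed37Dir_memberY` — `∃ M_F a_F B_F δ_F > 0` (on `d, ℓ, N, c₀`) such that for `G ≤ U(N)`, every member `x` with `M_F ≤ M_x`, `α₀ > 0`, `c₀·M_x·α₀ ≤ a_F`,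
  `U ∈ (bg9Y…).Reg335 c₀ α₀`, a level-∕1-faithful `bI`, any `R₀ H₀`, ANY walk-letter records `𝔬 𝔡 𝔩` over the cubes with the pins `𝔬.blk = blkSK (sIK bI)`,
  `𝔬.h = hWalkY x`, `𝔬.Gsq U c = gsqcoS … c U`, `𝔡.Dd U ν = η⁻¹ • coordOpK (cdSL U ν)`, `𝔡.Dsd U μ = η⁻¹ • coordOpK (cdsSL U μ)`, and the DISPLAYED data
  `StaticOK 𝔬 ρ N N′ C_ℓ κ`, `κ.Nonneg`, `Facts347 (geo9Y x) R₀ H₀ d_F δ α L₀`, `0 ≤ αδ`, `Ineq261 d₁ (toB6 (geo9Y x) R₀ H₀) δ_L α₁` at any legs' rate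
  `0 < δ_L ≤ δ_F`, `0 ≤ ρ′ ≤ (1 − α₁)δ_L`, `Identities₂ 𝔬 𝔡 𝔩 R₀ H₀ U`, plus the TWO LETTER TRANSPOSES `hPt hCt`:
  `FactorsL2Mixed37Dir 𝔬 𝔡 𝔩 R₀ H₀ θ_F ρ′ U` with `θ_F = ((d+1)·θ_P·B_F + θ_C·B_F·L₀)·c₁(d₁,δ_L,α₁)`, `θ_P = √(kP·kPt·L₀)·e^{(αδ∕2+αδ+ρ′)ρ}`, `θ_C = √(kC·kCt·L₀²)·e^{(…)ρ}`.
NET FOR THE KNIT (the owner's call, any edition): the displayed conjunct `FactorsL2Mixed37Dir (𝔬 x) (𝔡 x) (𝔩 x) 1 (H x) pM.θM p.δ₀ U` of `h36H` ↦ the two transposes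
`∀ c ν, IsTransposePair ((𝔩 x).P U c ν) ((𝔩 x).Pt U c ν)`, `∀ c, IsTransposePair ((𝔬 x).Cop U c) ((𝔬 x).Ct U c)` (inhabited by def-Y's `Node00/OpsYDirTranspose`-type letters
once `𝔩` is pinned; displayed until then) + the numerics side conditions `p.δ₀ ≤ ρ′`, `θ_F ≤ pM.θM` (§1).

HONEST SCOPE.  Composition + monotonicity over landed modules; the transposes, `Facts347`, `Ineq261`, `Identities₂`, `StaticOK` are HYPOTHESES where used; the legs are
theorems (dag-n06-w1's cube estimates through this seat's readings); nothing of [B9] asserted beyond kernel-checked parents; COUNT-NEUTRAL; N06 NOT discharged; K1⁹ NOT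
closed; nothing continuum ∕ OS ∕ mass gap ∕ Clay.  NEW file; nothing landed is modified; 0 `def`.
-/

noncomputable section

namespace Literature.MathematicalPhysics.QuantumFieldTheory.Balaban1983to89.B9RWSums346MixedFactorAtPins

open Literature.MathematicalPhysics.QuantumFieldTheory.Balaban1983to89
open Node00 B6KLevelCensusIndexV1 B6Geom246MultiLevelBox B6MultiLevelTorusOperator B6GlobalChartV1 B9BackgroundsKLevelV1
  B9Eq39Adjoint B6Geom246MultiLevelTorus B9Eq346OneSidedLegsAtPinsL2 B9RWSums346MixedFactorFromLegs B9RWSums346LetterL2FromMajorants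
open Literature.MathematicalPhysics.QuantumFieldTheory.Balaban1983to89.B6Ineq2142KLevelV1 (lvl β)
open Literature.MathematicalPhysics.QuantumFieldTheory.Balaban1983to89.B6RandomWalk (Ineq261)
open Literature.MathematicalPhysics.QuantumFieldTheory.Balaban1983to89.B9Ineq349SiteComposite (cdSL cdsSL etaS_pos)
open Literature.MathematicalPhysics.QuantumFieldTheory.Balaban1983to89.B9CoReadingCoords (coordOpK)
open Literature.MathematicalPhysics.QuantumFieldTheory.Balaban1983to89.B9CoReadingCoordsS (XSK blkSK sIK)
open Literature.MathematicalPhysics.QuantumFieldTheory.Balaban1983to89.B9CoReadingCoordsTranspose (TrIdx trBasis)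
open Literature.MathematicalPhysics.QuantumFieldTheory.Balaban1983to89.B9Thm34Ext (toB6)
open Literature.MathematicalPhysics.QuantumFieldTheory.Balaban1983to89.B9SectDL2Decay (BlockBd bl2_nonneg)
open Literature.MathematicalPhysics.QuantumFieldTheory.Balaban1983to89.B9PinMembersKLevelV1 (MemberY geo9Y bg9Y)
open Literature.MathematicalPhysics.QuantumFieldTheory.Balaban1983to89.B9Thm37Sum (mulOp)
open Literature.MathematicalPhysics.QuantumFieldTheory.Balaban1983to89.B9Thm37Glue (IsTransposePair)
open Literature.MathematicalPhysics.QuantumFieldTheory.Balaban1983to89.B9Thm37Whole (Ops StaticOK Sizes)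
open Literature.MathematicalPhysics.QuantumFieldTheory.Balaban1983to89.B9Thm37WholeDir (DirLetters37 Identities₂)
open Literature.MathematicalPhysics.QuantumFieldTheory.Balaban1983to89.B9Thm37KLetterDir (KopDir FactorsL2Mixed37Dir)
open Literature.MathematicalPhysics.QuantumFieldTheory.Balaban1983to89.B9RWSums346SecondDiffGp (DirOps37)
open Literature.MathematicalPhysics.QuantumFieldTheory.Balaban1983to89.B9RWSums343to347Whole (Facts347)
open Literature.MathematicalPhysics.QuantumFieldTheory.Balaban1983to89.B6Cover236MultiLevelBlocks (cubes)
open Literature.MathematicalPhysics.QuantumFieldTheory.Balaban1983to89.B9WalkLettersCoordsS (hWalkY gsqcoS)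
open scoped Matrix Matrix.Norms.L2Operator

/-! ## §1 Monotonicity of the schema in its numerics -/

section Mono

variable {g : B9.Geometry} [Fintype g.Site] [DecidableEq g.Site] {R : ℝ} {H : Prop} {B : B9.Backgrounds}
variable {X Y ι Dir : Type} [Fintype X] [Fintype Dir]

/-- `FactorsL2Mixed37Dir` is monotone: a larger constant and a smaller rate are again admissible (nonnegative constant, nonnegative distances) — the knit matches
its own numerics `(pM.θM, p.δ₀)`. [cite: Balaban1985BackgroundPropagators, (3.89) p.409 + (3.46) p.398, bookkeeping] -/
theorem factorsL2Mixed37Dir_mono (𝔬 : Ops g B X Y ι) (𝔡 : DirOps37 𝔬 Dir) (𝔩 : DirLetters37 𝔬 Dir) {θ θ' δ δ' : ℝ} (U : B.Cfg)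
    (hθ0 : 0 ≤ θ) (hθ : θ ≤ θ') (hδ : δ' ≤ δ) (hdnn : ∀ y y' : g.Site, 0 ≤ g.dist y y') (hlen : ∀ y : g.Site, 0 < g.len y)
    (h : FactorsL2Mixed37Dir 𝔬 𝔡 𝔩 R H θ δ U) : FactorsL2Mixed37Dir 𝔬 𝔡 𝔩 R H θ' δ' U := by
  refine ⟨fun i μ => (h.facDs i μ).mono fun y y' => ?_⟩
  have hind : 0 ≤ (if y ∈ 𝔬.S' i then (1 : ℝ) else 0) := by split_ifs <;> norm_num
  have hl : 0 ≤ g.len y ^ (-1 : ℝ) := Real.rpow_nonneg (hlen y).le _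
  have hexp : Real.exp (-(δ * g.dist y y')) ≤ Real.exp (-(δ' * g.dist y y')) :=
    Real.exp_le_exp.mpr (neg_le_neg (mul_le_mul_of_nonneg_right hδ (hdnn y y')))
  exact mul_le_mul_of_nonneg_left (mul_le_mul (mul_le_mul_of_nonneg_right hθ hl) hexp (Real.exp_nonneg _) (mul_nonneg (hθ0.trans hθ) hl)) hind

end Mono

/-! ## §2 The schema at the certificate's pins, member level -/

section AtPins

/-- ★★★ **ROWS 18's `FactorsL2Mixed37Dir` AT THE CERTIFICATE's PINS**: `∃ M_F a_F B_F δ_F > 0` such that, for every member in the regime, every configuration of the (3.35) class,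
every faithful `bI`, every `R₀ H₀`, ALL walk-letter records over the cubes with the certificate's pins, the displayed data `StaticOK ∕ Sizes.Nonneg ∕ Facts347 ∕ Ineq261 ∕ Identities₂`
(the row sum at any legs' rate `0 < δ_L ≤ δ_F`, target rate `0 ≤ ρ′ ≤ (1 − α₁)δ_L`, `0 ≤ αδ`) and the two letter transposes give
`FactorsL2Mixed37Dir 𝔬 𝔡 𝔩 R₀ H₀ θ_F ρ′ U`, `θ_F = ((d+1)·θ_P·B_F + θ_C·B_F·L₀)·c₁(d₁,δ_L,α₁)` — the mixed third-order factor of (3.88)–(3.89) in block-`L²`, no longer posited.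
[cite: Balaban1985BackgroundPropagators, (3.88)–(3.89) p.409, (3.46) p.398, Cor 3.6 p.408, (3.35) p.396; Balaban1984PropagatorsII, (2.39)–(2.44) pp.229–230, (2.52)–(2.55) p.232, Lemma 2.1 (2.61) p.234; Agmon1982, Ch.1, Thm 1.5] -/
theorem factorsL2Mixed37Dir_memberY (d ℓ : ℕ) (hd : 1 ≤ d + 1) (hL : Odd (ℓ + 1) ∧ 1 < ℓ + 1) (b₀ b₁ : ℝ) (Mstar N : ℕ) [NeZero N] {c₀ : ℝ} (hc₀ : 0 < c₀) :
    ∃ MF aF BF δF : ℝ, 0 < MF ∧ 0 < aF ∧ 0 < BF ∧ 0 < δF ∧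
      ∀ {G : Subgroup (Matrix (Fin N) (Fin N) ℂ)ˣ} (_ : G ≤ B7Prop2Explicit.unitaryUnits (Matrix (Fin N) (Fin N) ℂ))
        (x : MemberY d ℓ hd hL b₀ b₁ Mstar), MF ≤ (geo9Y x).M → ∀ α₀ : ℝ, 0 < α₀ → c₀ * (geo9Y x).M * α₀ ≤ aF →
      ∀ (U : (bg9Y (Matrix (Fin N) (Fin N) ℂ) G x).Cfg), (bg9Y (Matrix (Fin N) (Fin N) ℂ) G x).Reg335 c₀ α₀ U →
      ∀ {bI : FBondY x.toKIdx → IBondY x.toKIdx} (_ : ∀ f, lvl x.hN x.D x.hk (bI f) = (blkV1 x.hN x.D f).1.1)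
        (_ : ∀ f, (geomT x.D).dist (β x.hN x.D x.hk (bI f)) (blkV1 x.hN x.D f) ≤ 1) (R₀ : ℝ) (H₀ : Prop) [Fintype (geo9Y x).Site] [DecidableEq (geo9Y x).Site]
        {Y : Type} [Fintype Y] (𝔬 : Ops (geo9Y x) (bg9Y (Matrix (Fin N) (Fin N) ℂ) G x) (XSK (TrIdx N) x.toKIdx) Y ↥(cubes x.toKIdx.D.toDomains))
        (𝔡 : DirOps37 𝔬 (Fin (d + 1))) (𝔩 : DirLetters37 𝔬 (Fin (d + 1)))
        (_ : 𝔬.blk = blkSK x.toKIdx (sIK x.toKIdx bI)) (_ : ∀ c, 𝔬.h c = hWalkY x c)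
        (_ : ∀ c, 𝔬.Gsq U c = gsqcoS x (trBasis N) (bg9Y (Matrix (Fin N) (Fin N) ℂ) G x) (fun U => U) (parSymY x.toKIdx) c U)
        (_ : ∀ ν, 𝔡.Dd U ν = (etaS x.toKIdx)⁻¹ • coordOpK (trBasis N) (fun _ : Fin (d + 1) => (cdSL x.toKIdx U ν).restrictScalars ℝ))
        (_ : ∀ μ, 𝔡.Dsd U μ = (etaS x.toKIdx)⁻¹ • coordOpK (trBasis N) (fun _ : Fin (d + 1) => (cdsSL x.toKIdx U μ).restrictScalars ℝ))
        {ρ Nn N' Cℓ : ℝ} {κ : Sizes} (_ : StaticOK 𝔬 ρ Nn N' Cℓ κ) (_ : κ.Nonneg)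
        {dF d₁ : ℕ} {δ α L₀ α₁ δL ρ' : ℝ} (_ : Facts347 (geo9Y x) R₀ H₀ dF δ α L₀) (_ : 0 ≤ α * δ)
        (_ : 0 < δL) (_ : δL ≤ δF) (_ : Ineq261 d₁ (toB6 (geo9Y x) R₀ H₀) δL α₁) (_ : 0 ≤ ρ') (_ : ρ' ≤ (1 - α₁) * δL)
        (_ : Identities₂ 𝔬 𝔡 𝔩 R₀ H₀ U) (_ : ∀ c ν, IsTransposePair (𝔩.P U c ν) (𝔩.Pt U c ν)) (_ : ∀ c, IsTransposePair (𝔬.Cop U c) (𝔬.Ct U c)),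
        FactorsL2Mixed37Dir 𝔬 𝔡 𝔩 R₀ H₀
          (((Fintype.card (Fin (d + 1)) : ℝ) * ((Real.sqrt (κ.kP * κ.kPt * L₀ ^ |(1 : ℝ)|) * Real.exp ((α * δ / 2 + (α * δ + ρ')) * ρ)) * BF) +
              (Real.sqrt (κ.kC * κ.kCt * L₀ ^ |(2 : ℝ)|) * Real.exp ((α * δ / 2 + (α * δ + ρ')) * ρ)) * (BF * L₀)) * B6.c1 d₁ δL α₁) ρ' U := by
  obtain ⟨MM, aM, BM, δM, hMM, haM, hBM, hδM, HM⟩ := blockBd_mixedLegR_memberY d ℓ hd hL b₀ b₁ Mstar N hc₀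
  obtain ⟨M1, a1, B1, δ1, hM1, ha1, hB1, hδ1, H1⟩ := blockBd_oneLeg_memberY d ℓ hd hL b₀ b₁ Mstar N hc₀
  refine ⟨max MM M1, min aM a1, max BM B1, min δM δ1, lt_max_of_lt_left hMM, lt_min haM ha1, lt_max_of_lt_left hBM, lt_min hδM hδ1, ?_⟩
  intro G hG x hM α₀ hα₀ ha U hU bI hlev hβ1 R₀ H₀ _ _ Y _ 𝔬 𝔡 𝔩 hblk hh hGsq hDd hDsd ρ Nn N' Cℓ κ hs hκ dF d₁ δ α L₀ α₁ δL ρ' hF hαδ hδL0 hδLF h261 hρ' hrate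
    hi hPt hCt
  have hMM' : MM ≤ (geo9Y x).M := (le_max_left _ _).trans hM
  have hM1' : M1 ≤ (geo9Y x).M := (le_max_right _ _).trans hM
  have haM' : c₀ * (geo9Y x).M * α₀ ≤ aM := ha.trans (min_le_left _ _)
  have ha1' : c₀ * (geo9Y x).M * α₀ ≤ a1 := ha.trans (min_le_right _ _)
  have hδLM : δL ≤ δM := hδLF.trans (min_le_left _ _)
  have hδL1 : δL ≤ δ1 := hδLF.trans (min_le_right _ _)
  have hdnn : ∀ a a' : (geo9Y x).Site, 0 ≤ (geo9Y x).dist a a' := hs.dnn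
  -- the two legs at the pins, weakened to the common constant `max BM B1` and the chosen rate `δL`
  have hMix : ∀ (c : ↥(cubes x.toKIdx.D.toDomains)) (ν μ : Fin (d + 1)),
      BlockBd (g := toB6 (geo9Y x) R₀ H₀) 𝔬.blk 𝔬.blk (𝔡.Dd U ν ∘ₗ ((𝔬.Gsq U c * mulOp (𝔬.h c)) ∘ₗ 𝔡.Dsd U μ))
        (fun (y y' : (geo9Y x).Site) => max BM B1 * Real.exp (-(δL * (geo9Y x).dist y y'))) := by
    intro c ν μ
    refine (HM hG x hMM' α₀ hα₀ haM' U hU hlev hβ1 R₀ H₀ 𝔬 𝔡 c c ν μ hblk (hh c) (hGsq c) (hDd ν) (hDsd μ)).mono fun y y' => ?_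
    exact mul_le_mul (le_max_left _ _) (Real.exp_le_exp.mpr (neg_le_neg (mul_le_mul_of_nonneg_right hδLM (hdnn y y')))) (Real.exp_nonneg _)
      (hBM.le.trans (le_max_left _ _))
  have hOne : ∀ (c : ↥(cubes x.toKIdx.D.toDomains)) (μ : Fin (d + 1)),
      BlockBd (g := toB6 (geo9Y x) R₀ H₀) 𝔬.blk 𝔬.blk ((𝔬.Gsq U c * mulOp (𝔬.h c)) ∘ₗ 𝔡.Dsd U μ)
        (fun (y y' : (geo9Y x).Site) => max BM B1 * (geo9Y x).len y ^ (1 : ℝ) * Real.exp (-(δL * (geo9Y x).dist y y'))) := by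
    intro c μ
    refine (H1 hG x hM1' α₀ hα₀ ha1' U hU hlev hβ1 R₀ H₀ 𝔬 𝔡 c c μ hblk (hh c) (hGsq c) (hDsd μ)).mono fun y y' => ?_
    have hl : 0 ≤ (geo9Y x).len y ^ (1 : ℝ) := Real.rpow_nonneg (hs.lenpos y).le _
    exact mul_le_mul (mul_le_mul_of_nonneg_right (le_max_right _ _) hl)
      (Real.exp_le_exp.mpr (neg_le_neg (mul_le_mul_of_nonneg_right hδL1 (hdnn y y')))) (Real.exp_nonneg _)
      (mul_nonneg (hBM.le.trans (le_max_left _ _)) hl)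
  exact factorsL2Mixed37Dir_of_identities₂_legs 𝔬 𝔡 𝔩 R₀ H₀ dF d₁ δ α L₀ δL α₁ ρ Nn N' Cℓ ρ' (max BM B1) (max BM B1) κ U
    (hBM.le.trans (le_max_left _ _)) (hBM.le.trans (le_max_left _ _)) hρ' hrate hαδ hs hκ h261 hF hi hPt hCt hMix hOne

end AtPins

/-! ## §3 The constant made member-uniform through the certificate's `Sizes.Bounded` -/

section Uniform

variable {g : B9.Geometry} [Fintype g.Site] [DecidableEq g.Site] {R : ℝ} {H : Prop} {B : B9.Backgrounds}
variable {X Y ι Dir : Type} [Fintype X] [Fintype Dir]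

/-- under `Sizes.Bounded Kc θ₀ Cℓ M` with `M ≥ 1`, `Cℓ ≥ 1` the four letter sizes are `≤ θ₀`: `kP, kC, kPt, kCt ≤ θ₀` (rows `kP + kC ≤ θ₀M⁻¹`, columns `kPt + CℓkCt ≤ θ₀M⁻¹`).
[cite: Balaban1985BackgroundPropagators, (3.89) p.409; Balaban1984PropagatorsII, (2.44) p.230, bookkeeping] -/
theorem sizes_le_of_bounded {κ : Sizes} {Kc θ₀ Cℓ M : ℝ} (hκ : κ.Bounded Kc θ₀ Cℓ M) (hM : 1 ≤ M) (hCℓ : 1 ≤ Cℓ) (hθ₀ : 0 ≤ θ₀) :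
    κ.kP ≤ θ₀ ∧ κ.kC ≤ θ₀ ∧ κ.kPt ≤ θ₀ ∧ κ.kCt ≤ θ₀ := by
  have hMinv : θ₀ * M⁻¹ ≤ θ₀ := by
    have : M⁻¹ ≤ 1 := inv_le_one_of_one_le₀ hM
    nlinarith
  have hrow := hκ.row
  have hcol := hκ.col
  have h1 := hκ.nonneg.kP
  have h2 := hκ.nonneg.kC
  have h3 := hκ.nonneg.kPt
  have h4 := hκ.nonneg.kCt
  refine ⟨by linarith, by linarith, by nlinarith, ?_⟩
  have : Cℓ * κ.kCt ≤ θ₀ := by nlinarith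
  nlinarith

/-- ★ **THE SCHEMA WITH A MEMBER-UNIFORM CONSTANT**: `FactorsL2Mixed37Dir … θ ρ′ U` at the §2 constant `θ = ((d+1)·√(kP·kPt·L₀^{|1|})·e·B + √(kC·kCt·L₀^{|2|})·e·B·L₀)·c₁` implies it at
`θ⋆ = ((d+1)·θ₀·√(L₀^{|1|})·e·B + θ₀·√(L₀^{|2|})·e·B·L₀)·c₁` whenever `κ.Bounded Kc θ₀ Cℓ M`, `M ≥ 1`, `Cℓ ≥ 1` (the certificate's `hκ`, p.M₁ ≥ 1, `p.OK.one_le_Cℓ`) — the sizes leave the constant.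
[cite: Balaban1985BackgroundPropagators, (3.89) p.409 («O(M⁻¹)»), (3.46) p.398; Balaban1984PropagatorsII, (2.44) p.230] -/
theorem factorsL2Mixed37Dir_uniform_of_bounded (𝔬 : Ops g B X Y ι) (𝔡 : DirOps37 𝔬 Dir) (𝔩 : DirLetters37 𝔬 Dir) (U : B.Cfg)
    {κ : Sizes} {Kc θ₀ Cℓ M nD L₀ e Bc c₁ ρ' : ℝ} (hκ : κ.Bounded Kc θ₀ Cℓ M) (hM : 1 ≤ M) (hCℓ : 1 ≤ Cℓ) (hθ₀ : 0 ≤ θ₀)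
    (hnD : 0 ≤ nD) (hL₀ : 0 ≤ L₀) (he : 0 ≤ e) (hBc : 0 ≤ Bc) (hc₁ : 0 ≤ c₁)
    (hdnn : ∀ y y' : g.Site, 0 ≤ g.dist y y') (hlen : ∀ y : g.Site, 0 < g.len y)
    (h : FactorsL2Mixed37Dir 𝔬 𝔡 𝔩 R H
      ((nD * ((Real.sqrt (κ.kP * κ.kPt * L₀ ^ |(1 : ℝ)|) * e) * Bc) + (Real.sqrt (κ.kC * κ.kCt * L₀ ^ |(2 : ℝ)|) * e) * (Bc * L₀)) * c₁) ρ' U) :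
    FactorsL2Mixed37Dir 𝔬 𝔡 𝔩 R H ((nD * ((θ₀ * Real.sqrt (L₀ ^ |(1 : ℝ)|) * e) * Bc) + (θ₀ * Real.sqrt (L₀ ^ |(2 : ℝ)|) * e) * (Bc * L₀)) * c₁) ρ' U := by
  obtain ⟨hP, hC, hPt, hCt⟩ := sizes_le_of_bounded hκ hM hCℓ hθ₀
  have h1 := hκ.nonneg.kP
  have h2 := hκ.nonneg.kC
  have h3 := hκ.nonneg.kPt
  have h4 := hκ.nonneg.kCt
  have hL1 : 0 ≤ L₀ ^ |(1 : ℝ)| := Real.rpow_nonneg hL₀ _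
  have hL2 : 0 ≤ L₀ ^ |(2 : ℝ)| := Real.rpow_nonneg hL₀ _
  have hsP : Real.sqrt (κ.kP * κ.kPt * L₀ ^ |(1 : ℝ)|) ≤ θ₀ * Real.sqrt (L₀ ^ |(1 : ℝ)|) := by
    rw [← Real.sqrt_sq hθ₀, ← Real.sqrt_mul (sq_nonneg θ₀)]
    exact Real.sqrt_le_sqrt (mul_le_mul_of_nonneg_right (by nlinarith [mul_le_mul hP hPt h3 hθ₀]) hL1)
  have hsC : Real.sqrt (κ.kC * κ.kCt * L₀ ^ |(2 : ℝ)|) ≤ θ₀ * Real.sqrt (L₀ ^ |(2 : ℝ)|) := by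
    rw [← Real.sqrt_sq hθ₀, ← Real.sqrt_mul (sq_nonneg θ₀)]
    exact Real.sqrt_le_sqrt (mul_le_mul_of_nonneg_right (by nlinarith [mul_le_mul hC hCt h4 hθ₀]) hL2)
  refine factorsL2Mixed37Dir_mono 𝔬 𝔡 𝔩 U ?_ ?_ le_rfl hdnn hlen h
  · positivity
  · have ha : nD * ((Real.sqrt (κ.kP * κ.kPt * L₀ ^ |(1 : ℝ)|) * e) * Bc) ≤ nD * ((θ₀ * Real.sqrt (L₀ ^ |(1 : ℝ)|) * e) * Bc) :=
      mul_le_mul_of_nonneg_left (mul_le_mul_of_nonneg_right (mul_le_mul_of_nonneg_right hsP he) hBc) hnD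
    have hb : (Real.sqrt (κ.kC * κ.kCt * L₀ ^ |(2 : ℝ)|) * e) * (Bc * L₀) ≤ (θ₀ * Real.sqrt (L₀ ^ |(2 : ℝ)|) * e) * (Bc * L₀) :=
      mul_le_mul_of_nonneg_right (mul_le_mul_of_nonneg_right hsC he) (mul_nonneg hBc hL₀)
    exact mul_le_mul_of_nonneg_right (add_le_add ha hb) hc₁

end Uniform

end Literature.MathematicalPhysics.QuantumFieldTheory.Balaban1983to89.B9RWSums346MixedFactorAtPins

end
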